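import Literature.AlgebraicGeometry.Resolution.QuasiSplitNormalFormPair
import Literature.AlgebraicGeometry.Resolution.AlterationsNormalFormBlowupParts
import Literature.AlgebraicGeometry.Resolution.PrincipalizationToResolution
import Summits.ResolutionOfSingularities.ResolutionOfSingularities.Theorems.WildQuotientsSummitReductionStubPairSsOrbitBlowupLemmas
import HarnessLib

/-!
# `WildQuotients.SummitReduction` (stmt-ResolutionOfSingularities-16324), line `FramePerfect`, stub S
# (`stub_pair_orbitNormalFormBlowup`): the orbit centre is a disjoint union of singular components

Route `ResolutionOfSingularities/WildQuotients`, crux `SummitReduction`; helper file of the line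
skeleton (v8), stub S = the orbit version of de Jong 1996, Claim 4.27 for
`DeJong1997.QuasiSplitNormalFormPair` (de Jong 1997, proof of Prop. 5.11 ¶3).

The centre blown up in the equivariant iteration is the closure of the orbit
`⋃_g ρ(g)(E)` of an irreducible component `E` of the singular locus
`Sing X = {x | 𝒪_{X,x} not regular}`. De Jong 1997, p. 619: "by the remarks at the end of
[1, 3.5] we have `Sing(X) = ⋃ E_α`, with `E_α` regular … Thus, as `D` is `G`-strict, we have
that `⋃_{g ∈ G} g(E_α)` is a disjoint union of components `E_β`." This file proves that
bookkeeping for an action `ρ : G →* Aut X` of a finite group (step (S1) of the stub):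

* `image_mem_componentsIn_singularLocus` — a translate `ρ(g)(E)` of an irreducible component of
  `Sing X` (as a subset of `X`, `componentsIn`) is again one;
* `closure_orbit_eq_iUnion` — for `E` closed the orbit `⋃_g ρ(g)(E)` is closed, so the centre
  of the stub, `closure (⋃_g ρ(g)(E))`, IS the finite union of the translates;
* `subset_orbit_iff_eq_translate` — a component of `Sing X` lies in the orbit of the component
  `E` iff it is a translate of `E`;
* `translate_eq_of_mem_of_mem` — **disjointness**: if the reduced closed subscheme on the orbit is
  a regular scheme (the field `isRegular_subscheme_orbit` of `QuasiSplitNormalFormPair`), two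
  translates of `E` that meet are equal (a point of a regular scheme lies on exactly one
  irreducible component, `Scheme.IsRegular.eq_of_mem_irreducibleComponents`, and the irreducible
  components of the orbit are the translates);
* `quasiSplitNormalFormPair_translate_eq_of_mem_of_mem`, `quasiSplitNormalFormPair_closure_orbit_eq`,
  `quasiSplitNormalFormPair_eq_translate_of_subset_closure_orbit` — the same for the structure.

## Sources

* A. J. de Jong, *Families of curves and alterations*, Ann. Inst. Fourier 47 (1997), proof of
  Prop. 5.11, p. 619. [DeJong1997]
* A. J. de Jong, *Smoothness, semi-stability and alterations*, Publ. Math. IHÉS 83 (1996), 3.5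
  (p. 64), 4.26–4.27 (pp. 75–76). [DeJong1996]
-/

set_option linter.dupNamespace false -- the tree's summit namespace repeats `ResolutionOfSingularities`

noncomputable section

open CategoryTheory CategoryTheory.Limits AlgebraicGeometry TopologicalSpace Topology
open Literature.AlgebraicGeometry.Resolution
open Literature.AlgebraicGeometry

namespace Summit.ResolutionOfSingularities.ResolutionOfSingularities.Theorems

/-! ## Translates of components of the singular locus -/

/-- `ρ(g⁻¹)` undoes `ρ(g)` on subsets. [folklore] -/
theorem image_inv_image_eq_of_action {X : Scheme.{0}} {G : Type} [Group G] (ρ : G →* Aut X)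
    (g : G) (E : Set X) : (ρ g⁻¹).hom.base '' ((ρ g).hom.base '' E) = E := by
  rw [image_image_eq_of_action, inv_mul_cancel, map_one]
  ext x
  exact ⟨by rintro ⟨y, hy, rfl⟩; exact hy, fun hx => ⟨x, hx, rfl⟩⟩

/-- **A translate of an irreducible component of the singular locus is an irreducible component
of the singular locus**: `ρ(g)` is a homeomorphism of `X` preserving `Sing X`.
[cite: DeJong1997, proof of Prop. 5.11, p. 619] -/
theorem image_mem_componentsIn_singularLocus {X : Scheme.{0}} {G : Type} [Group G]
    (ρ : G →* Aut X) (g : G) {E : Set X}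
    (hE : E ∈ componentsIn ({x : X | ¬ IsRegularLocalRing (X.presheaf.stalk x)} : Set X)) :
    (ρ g).hom.base '' E ∈
      componentsIn ({x : X | ¬ IsRegularLocalRing (X.presheaf.stalk x)} : Set X) := by
  rw [mem_componentsIn_iff] at hE ⊢
  obtain ⟨hES, hirr, hmax⟩ := hE
  refine ⟨(Set.image_mono hES).trans (image_singularLocus_eq_of_action ρ g).le,
    hirr.image _ (ρ g).hom.continuous.continuousOn, fun T hTS hT hle => ?_⟩
  -- pull `T` back by `ρ(g⁻¹)` and use the maximality of `E`
  have h1 : E ⊆ (ρ g⁻¹).hom.base '' T := by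
    rw [← image_inv_image_eq_of_action ρ g E]
    exact Set.image_mono hle
  have h2 : (ρ g⁻¹).hom.base '' T ⊆ E :=
    hmax _ ((Set.image_mono hTS).trans (image_singularLocus_eq_of_action ρ g⁻¹).le)
      (hT.image _ (ρ g⁻¹).hom.continuous.continuousOn) h1
  have h3 : (ρ g).hom.base '' ((ρ g⁻¹).hom.base '' T) = T := by
    simpa using image_inv_image_eq_of_action ρ g⁻¹ T
  rw [← h3]
  exact Set.image_mono h2

/-- **The orbit of a closed subset is closed** (finitely many closed translates), so the centre
of the stub, `closure (⋃_g ρ(g)(E))`, is the union of the translates itself. [folklore] -/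
theorem closure_orbit_eq_iUnion {X : Scheme.{0}} {G : Type} [Group G] [Finite G]
    (ρ : G →* Aut X) {E : Set X} (hE : IsClosed E) :
    closure (⋃ g : G, (ρ g).hom.base '' E) = ⋃ g : G, (ρ g).hom.base '' E :=
  (isClosed_iUnion_image ρ hE).closure_eq

/-- The image in `X` of an irreducible component of the (closed) singular locus, taken in the
subspace, is closed in `X`. [folklore] -/
theorem isClosed_image_val_of_mem_irreducibleComponents {X : Scheme.{0}}
    (hS : IsClosed ({x : X | ¬ IsRegularLocalRing (X.presheaf.stalk x)} : Set X))
    {E : Set ↥({x : X | ¬ IsRegularLocalRing (X.presheaf.stalk x)} : Set X)}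
    (hE : E ∈ irreducibleComponents ↥({x : X | ¬ IsRegularLocalRing (X.presheaf.stalk x)} : Set X)) :
    IsClosed (Subtype.val '' E) := by
  rw [← closure_image_val_eq hS hE]
  exact isClosed_closure

/-- The centre of the stub for a component `E` of the subspace `Sing X` (closed): the closure of
the orbit of `E` is the union of the translates of the closed set `E ⊆ X`. [folklore] -/
theorem closure_orbit_image_val_eq_iUnion {X : Scheme.{0}} {G : Type} [Group G] [Finite G]
    (ρ : G →* Aut X) (hS : IsClosed ({x : X | ¬ IsRegularLocalRing (X.presheaf.stalk x)} : Set X))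
    {E : Set ↥({x : X | ¬ IsRegularLocalRing (X.presheaf.stalk x)} : Set X)}
    (hE : E ∈ irreducibleComponents ↥({x : X | ¬ IsRegularLocalRing (X.presheaf.stalk x)} : Set X)) :
    closure (⋃ g : G, (ρ g).hom.base '' (Subtype.val '' E)) =
      ⋃ g : G, (ρ g).hom.base '' (Subtype.val '' E) :=
  closure_orbit_eq_iUnion ρ (isClosed_image_val_of_mem_irreducibleComponents hS hE)

/-- **A component of `Sing X` lies in the orbit of the component `E` iff it is a translate of
`E`**: an irreducible set inside a finite union of closed sets lies in one of them, and distinct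
components are incomparable. [cite: DeJong1997, proof of Prop. 5.11, p. 619] -/
theorem subset_orbit_iff_eq_translate {X : Scheme.{0}} {G : Type} [Group G] [Finite G]
    (ρ : G →* Aut X) (hS : IsClosed ({x : X | ¬ IsRegularLocalRing (X.presheaf.stalk x)} : Set X))
    {E E' : Set X}
    (hE : E ∈ componentsIn ({x : X | ¬ IsRegularLocalRing (X.presheaf.stalk x)} : Set X))
    (hE' : E' ∈ componentsIn ({x : X | ¬ IsRegularLocalRing (X.presheaf.stalk x)} : Set X)) :
    E' ⊆ ⋃ g : G, (ρ g).hom.base '' E ↔ ∃ g : G, (ρ g).hom.base '' E = E' := by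
  constructor
  · intro hsub
    have hEc : IsClosed E := componentsIn.isClosed hS hE
    let t : Finset (Set X) := (Set.finite_range fun g : G => (ρ g).hom.base '' E).toFinset
    obtain ⟨z, hz, hE'z⟩ := isIrreducible_iff_sUnion_isClosed.mp (componentsIn.isIrreducible hE') t
      (fun z hz => by
        obtain ⟨g, rfl⟩ := (Set.Finite.mem_toFinset _).mp hz
        exact (Scheme.homeoOfIso (ρ g)).isClosedMap E hEc)
      (by
        intro x hx
        obtain ⟨g, hg⟩ := Set.mem_iUnion.mp (hsub hx)
        exact ⟨_, (Set.Finite.mem_toFinset _).mpr ⟨g, rfl⟩, hg⟩)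
    obtain ⟨g, rfl⟩ := (Set.Finite.mem_toFinset _).mp hz
    refine ⟨g, Set.Subset.antisymm ?_ hE'z⟩
    have hgE := image_mem_componentsIn_singularLocus ρ g hE
    exact (mem_componentsIn_iff.mp hE').2.2 _ (componentsIn.subset hgE)
      (componentsIn.isIrreducible hgE) hE'z
  · rintro ⟨g, rfl⟩
    exact Set.subset_iUnion (fun g : G => (ρ g).hom.base '' E) g

/-- Two translates of a component of `Sing X`, one inside the other, are equal. [folklore] -/
theorem translate_eq_of_subset {X : Scheme.{0}} {G : Type} [Group G] (ρ : G →* Aut X)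
    {E : Set X} (hE : E ∈ componentsIn ({x : X | ¬ IsRegularLocalRing (X.presheaf.stalk x)} : Set X))
    {g g' : G} (h : (ρ g).hom.base '' E ⊆ (ρ g').hom.base '' E) :
    (ρ g).hom.base '' E = (ρ g').hom.base '' E := by
  have hg := image_mem_componentsIn_singularLocus ρ g hE
  have hg' := image_mem_componentsIn_singularLocus ρ g' hE
  exact Set.Subset.antisymm h ((mem_componentsIn_iff.mp hg).2.2 _ (componentsIn.subset hg')
    (componentsIn.isIrreducible hg') h)

/-- **The irreducible components of the orbit of a component `E` of `Sing X` are the translates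
of `E`** (a finite union of pairwise incomparable irreducible closed sets).
[cite: DeJong1997, proof of Prop. 5.11, p. 619] -/
theorem componentsIn_orbit_eq {X : Scheme.{0}} {G : Type} [Group G] [Finite G]
    (ρ : G →* Aut X) (hS : IsClosed ({x : X | ¬ IsRegularLocalRing (X.presheaf.stalk x)} : Set X))
    {E : Set X} (hE : E ∈ componentsIn ({x : X | ¬ IsRegularLocalRing (X.presheaf.stalk x)} : Set X)) :
    componentsIn (⋃ g : G, (ρ g).hom.base '' E) = Set.range fun g : G => (ρ g).hom.base '' E := by
  rw [← Set.sUnion_range]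
  refine componentsIn_sUnion_eq (Set.finite_range _) ?_ ?_ ?_
  · rintro _ ⟨g, rfl⟩
    exact componentsIn.isIrreducible (image_mem_componentsIn_singularLocus ρ g hE)
  · rintro _ ⟨g, rfl⟩
    exact (Scheme.homeoOfIso (ρ g)).isClosedMap E (componentsIn.isClosed hS hE)
  · rintro _ ⟨g, rfl⟩ _ ⟨g', rfl⟩ h
    exact translate_eq_of_subset ρ hE h

/-! ## Disjointness of the translates from the regularity of the orbit -/

/-- Homeomorphisms identify irreducible components (adapted from
`mem_irreducibleComponents_image_iff_of_homeomorph`, `KollarSplitBoundary.lean`). [folklore] -/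
theorem mem_irreducibleComponents_of_image_homeomorph {α β : Type*} [TopologicalSpace α]
    [TopologicalSpace β] (e : α ≃ₜ β) {A : Set α} (hA : e '' A ∈ irreducibleComponents β) :
    A ∈ irreducibleComponents α := by
  -- adapted from `mem_irreducibleComponents_image_of_homeomorph` (KollarSplitBoundary.lean)
  have key : ∀ (f : β ≃ₜ α) {C : Set β}, C ∈ irreducibleComponents β →
      f '' C ∈ irreducibleComponents α := by
    intro f C hC
    refine ⟨hC.1.image f f.continuous.continuousOn, fun D hD hCD => ?_⟩
    have hD' : IsIrreducible (f.symm '' D) := hD.image f.symm f.symm.continuous.continuousOn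
    have hCD' : C ⊆ f.symm '' D := fun x hx => ⟨f x, hCD ⟨x, hx, rfl⟩, f.symm_apply_apply x⟩
    have hEq : C = f.symm '' D := Set.Subset.antisymm hCD' (hC.2 hD' hCD')
    intro y hy
    refine ⟨f.symm y, ?_, f.apply_symm_apply y⟩
    rw [hEq]
    exact ⟨y, hy, rfl⟩
  have := key e.symm hA
  rwa [← Set.image_comp, show (e.symm ∘ e : α → α) = id from funext e.symm_apply_apply,
    Set.image_id] at this

/-- **Irreducible components of a closed subscheme**: along the closed immersion
`ι : Y = V(I_C) → X` onto the closed set `C`, the preimage of an irreducible component of `C`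
(as a subset of `X`, `componentsIn`) is an irreducible component of `Y`. [folklore] -/
theorem preimage_subschemeι_mem_irreducibleComponents {X : Scheme.{0}} (C : Closeds X)
    {T : Set X} (hT : T ∈ componentsIn (C : Set X)) :
    (Scheme.IdealSheafData.vanishingIdeal C).subschemeι.base ⁻¹' T ∈
      irreducibleComponents ↥(Scheme.IdealSheafData.vanishingIdeal C).subscheme := by
  set I := Scheme.IdealSheafData.vanishingIdeal C with hI
  have hemb : IsEmbedding I.subschemeι.base := I.subschemeι.isClosedEmbedding.isEmbedding
  have hrange : Set.range I.subschemeι.base = (C : Set X) := by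
    rw [hI]
    exact (Scheme.IdealSheafData.range_subschemeι _).trans
      (Scheme.IdealSheafData.coe_support_vanishingIdeal C)
  -- the homeomorphism `Y ≃ₜ C`
  let e : ↥I.subscheme ≃ₜ ↥(C : Set X) := hemb.toHomeomorph.trans (Homeomorph.setCongr hrange)
  have he : ∀ y, (e y).1 = I.subschemeι.base y := fun y => rfl
  obtain ⟨T₀, hT₀, rfl⟩ := hT
  refine mem_irreducibleComponents_of_image_homeomorph e ?_
  convert hT₀ using 1
  ext c
  simp only [Set.mem_image, Set.mem_preimage]
  constructor
  · rintro ⟨y, ⟨c', hc', hc'y⟩, rfl⟩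
    have : c' = e y := Subtype.ext (by rw [he]; exact hc'y)
    rwa [← this]
  · intro hc
    refine ⟨e.symm c, ⟨c, hc, ?_⟩, e.apply_symm_apply c⟩
    rw [← he, e.apply_symm_apply]

/-- **Two irreducible components of a closed set `C ⊆ X` whose reduced closed subscheme is
regular are disjoint or equal**: a point of a regular scheme lies on exactly one irreducible
component (`Scheme.IsRegular.eq_of_mem_irreducibleComponents`). [folklore] -/
theorem eq_of_mem_componentsIn_of_isRegular_subscheme {X : Scheme.{0}} (C : Closeds X)
    (hreg : Scheme.IsRegular (Scheme.IdealSheafData.vanishingIdeal C).subscheme)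
    {T T' : Set X} (hT : T ∈ componentsIn (C : Set X)) (hT' : T' ∈ componentsIn (C : Set X))
    {x : X} (hx : x ∈ T) (hx' : x ∈ T') : T = T' := by
  set I := Scheme.IdealSheafData.vanishingIdeal C with hI
  have hrange : Set.range I.subschemeι.base = (C : Set X) := by
    rw [hI]
    exact (Scheme.IdealSheafData.range_subschemeι _).trans
      (Scheme.IdealSheafData.coe_support_vanishingIdeal C)
  obtain ⟨y, rfl⟩ : x ∈ Set.range I.subschemeι.base := hrange ▸ componentsIn.subset hT hx
  have key := hreg.eq_of_mem_irreducibleComponents y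
    (preimage_subschemeι_mem_irreducibleComponents C hT)
    (preimage_subschemeι_mem_irreducibleComponents C hT') hx hx'
  -- push forward again: `ι '' (ι ⁻¹' T) = T`
  have himg : ∀ {T : Set X}, T ∈ componentsIn (C : Set X) →
      I.subschemeι.base '' (I.subschemeι.base ⁻¹' T) = T := fun hT => by
    rw [Set.image_preimage_eq_inter_range, hrange]
    exact Set.inter_eq_left.mpr (componentsIn.subset hT)
  rw [← himg hT, ← himg hT', key]

/-- **The translates of a component `E` of `Sing X` are pairwise disjoint or equal when the
reduced closed subscheme on the orbit is regular** (de Jong 1997, p. 619: "`⋃_{g ∈ G} g(E_α)`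
is a disjoint union of components `E_β`"; a regular local ring is a domain, so a point of the
orbit lies on one translate only). [cite: DeJong1997, proof of Prop. 5.11, p. 619] -/
theorem translate_eq_of_mem_of_mem {X : Scheme.{0}} {G : Type} [Group G] [Finite G]
    (ρ : G →* Aut X) (hS : IsClosed ({x : X | ¬ IsRegularLocalRing (X.presheaf.stalk x)} : Set X))
    {E : Set X} (hE : E ∈ componentsIn ({x : X | ¬ IsRegularLocalRing (X.presheaf.stalk x)} : Set X))
    (hreg : Scheme.IsRegular (Scheme.IdealSheafData.vanishingIdeal
      ⟨⋃ g : G, (ρ g).hom.base '' E,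
        isClosed_iUnion_image ρ (componentsIn.isClosed hS hE)⟩).subscheme)
    {g g' : G} {x : X} (hx : x ∈ (ρ g).hom.base '' E) (hx' : x ∈ (ρ g').hom.base '' E) :
    (ρ g).hom.base '' E = (ρ g').hom.base '' E := by
  have hcomp := componentsIn_orbit_eq ρ hS hE
  refine eq_of_mem_componentsIn_of_isRegular_subscheme
    ⟨⋃ g : G, (ρ g).hom.base '' E, isClosed_iUnion_image ρ (componentsIn.isClosed hS hE)⟩
    hreg ?_ ?_ hx hx'
  · show (ρ g).hom.base '' E ∈ componentsIn (⋃ g : G, (ρ g).hom.base '' E)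
    rw [hcomp]
    exact ⟨g, rfl⟩
  · show (ρ g').hom.base '' E ∈ componentsIn (⋃ g : G, (ρ g).hom.base '' E)
    rw [hcomp]
    exact ⟨g', rfl⟩

/-- Disjointness form of `translate_eq_of_mem_of_mem`. [cite: DeJong1997, proof of Prop. 5.11, p. 619] -/
theorem disjoint_translate_of_ne {X : Scheme.{0}} {G : Type} [Group G] [Finite G]
    (ρ : G →* Aut X) (hS : IsClosed ({x : X | ¬ IsRegularLocalRing (X.presheaf.stalk x)} : Set X))
    {E : Set X} (hE : E ∈ componentsIn ({x : X | ¬ IsRegularLocalRing (X.presheaf.stalk x)} : Set X))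
    (hreg : Scheme.IsRegular (Scheme.IdealSheafData.vanishingIdeal
      ⟨⋃ g : G, (ρ g).hom.base '' E,
        isClosed_iUnion_image ρ (componentsIn.isClosed hS hE)⟩).subscheme)
    {g g' : G} (hne : (ρ g).hom.base '' E ≠ (ρ g').hom.base '' E) :
    Disjoint ((ρ g).hom.base '' E) ((ρ g').hom.base '' E) :=
  Set.disjoint_left.mpr fun _ hx hx' => hne (translate_eq_of_mem_of_mem ρ hS hE hreg hx hx')

/-! ## For the structure `QuasiSplitNormalFormPair` -/

section QuasiSplitNormalFormPair

variable {k : Type} [Field k] {X : Scheme.{0}} {p : X ⟶ Spec (.of k)} {Z : Set X}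
  {G : Type} [Group G] [Finite G] {ρ : G →* Aut X} {d : ℕ}

/-- **The centre of the stub is the union of the translates**: for a `QuasiSplitNormalFormPair`
and an irreducible component `E` of the subspace `Sing X`, the closure of the orbit of `E` is
`⋃_g ρ(g)(E)`. [cite: DeJong1997, proof of Prop. 5.11, p. 619] -/
theorem quasiSplitNormalFormPair_closure_orbit_eq (h : DeJong1997.QuasiSplitNormalFormPair p Z ρ d)
    {E : Set ↥({x : X | ¬ IsRegularLocalRing (X.presheaf.stalk x)} : Set X)}
    (hE : E ∈ irreducibleComponents ↥({x : X | ¬ IsRegularLocalRing (X.presheaf.stalk x)} : Set X)) :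
    closure (⋃ g : G, (ρ g).hom.base '' (Subtype.val '' E)) =
      ⋃ g : G, (ρ g).hom.base '' (Subtype.val '' E) :=
  closure_orbit_image_val_eq_iUnion ρ h.isClosed_setOf_not_isRegularLocalRing hE

/-- **"`⋃_{g ∈ G} g(E_α)` is a disjoint union of components `E_β`"** for a
`QuasiSplitNormalFormPair`: two translates of an irreducible component `E` of `Sing X` through a
common point coincide (field `isRegular_subscheme_orbit`). [cite: DeJong1997, proof of Prop. 5.11, p. 619] -/
theorem quasiSplitNormalFormPair_translate_eq_of_mem_of_mem {k : Type} [Field k] {X : Scheme.{0}}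
    {p : X ⟶ Spec (.of k)} {Z : Set X} {G : Type} [Group G] [Finite G] {ρ : G →* Aut X} {d : ℕ}
    (h : DeJong1997.QuasiSplitNormalFormPair p Z ρ d)
    {E : Set ↥({x : X | ¬ IsRegularLocalRing (X.presheaf.stalk x)} : Set X)}
    (hE : E ∈ irreducibleComponents ↥({x : X | ¬ IsRegularLocalRing (X.presheaf.stalk x)} : Set X))
    {g g' : G} {x : X} (hx : x ∈ (ρ g).hom.base '' (Subtype.val '' E))
    (hx' : x ∈ (ρ g').hom.base '' (Subtype.val '' E)) :
    (ρ g).hom.base '' (Subtype.val '' E) = (ρ g').hom.base '' (Subtype.val '' E) := by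
  have hS := h.isClosed_setOf_not_isRegularLocalRing
  have hreg := h.isRegular_subscheme_orbit E hE
  have hcl : (⟨closure (⋃ g : G, (ρ g).hom.base '' (Subtype.val '' E)), isClosed_closure⟩ :
      Closeds X) = ⟨⋃ g : G, (ρ g).hom.base '' (Subtype.val '' E),
        isClosed_iUnion_image ρ (componentsIn.isClosed hS (componentsIn.image_val_mem hE))⟩ :=
    Closeds.ext (quasiSplitNormalFormPair_closure_orbit_eq h hE)
  rw [hcl] at hreg
  exact translate_eq_of_mem_of_mem ρ hS (componentsIn.image_val_mem hE) hreg hx hx'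

/-- A component of `Sing X` inside the centre is a translate of `E`. [cite: DeJong1997, proof of Prop. 5.11, p. 619] -/
theorem quasiSplitNormalFormPair_eq_translate_of_subset_closure_orbit (h : DeJong1997.QuasiSplitNormalFormPair p Z ρ d)
    {E : Set ↥({x : X | ¬ IsRegularLocalRing (X.presheaf.stalk x)} : Set X)}
    (hE : E ∈ irreducibleComponents ↥({x : X | ¬ IsRegularLocalRing (X.presheaf.stalk x)} : Set X))
    {E' : Set X} (hE' : E' ∈ componentsIn ({x : X | ¬ IsRegularLocalRing (X.presheaf.stalk x)} : Set X))
    (hsub : E' ⊆ closure (⋃ g : G, (ρ g).hom.base '' (Subtype.val '' E))) :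
    ∃ g : G, (ρ g).hom.base '' (Subtype.val '' E) = E' := by
  rw [quasiSplitNormalFormPair_closure_orbit_eq h hE] at hsub
  exact (subset_orbit_iff_eq_translate ρ h.isClosed_setOf_not_isRegularLocalRing
    (componentsIn.image_val_mem hE) hE').mp hsub

end QuasiSplitNormalFormPair

end Summit.ResolutionOfSingularities.ResolutionOfSingularities.Theorems

end
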